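import Summits.ValiantsHypothesis.ValiantsHypothesis.Theorems.SymPencilSdcPerFourKernelPackage
import Summits.ValiantsHypothesis.ValiantsHypothesis.Theorems.SymPencilPerFourHessianBlocks
import Summits.ValiantsHypothesis.ValiantsHypothesis.Theorems.SymPencilSdcSuperquadraticStubBlockRankFour
import Summits.ValiantsHypothesis.ValiantsHypothesis.Theorems.SymPencilSdcPerFourWindow

/-!
# Route `SymPencil` — `sdc(per_4) ≥ 23`: seven more than the variable count
# (next rung after line `box_four`, `--supports` stmt-ValiantsHypothesis-5674 `SdcSuperquadratic`)

**Theorem** (`twentyThree_le_of_isSymm_isAffineDetRepr_perPoly_four`).  Over a field of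
characteristic `0`, every SYMMETRIC affine determinantal representation of the `4 × 4` permanent
has size `m ≥ 23 = 4² + 7`.  (Tree before this file: `21`, `SymPencilSdcPerFourTwentyOne`.)

Proof (`false_of_isSymm_isAffineDetRepr_perPoly_four_le_twentyTwo`).  Two-sided kernel package
(`SymPencilSdcPerFourKernelPackage`): `V ⊆ Sing Z(per_4)`, `dim V + r = 16`, `2r + 1 ≤ m ≤ 22`,
`dim V ≤ 8`, so `r ∈ {8, 9, 10}`.

* `r = 8`: `dim V = 8` and the `s²`-coefficient is, for each base point, a sum of `5 ≥ m - 17`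
  squares in `y`; by the BoxFour equality case (`SymPencilBoxFourEquality.two_rows_or_two_cols`,
  val-width-5676-p2 g3) `V` is a two-row block, where no family of `< 8` squares exists
  (`SymPencilSdcSuperquadraticStubBlockRankFour.not_sum_sq_family_of_card_lt`, val-width-5674-p1).
* `r ∈ {9, 10}`: `dim V ∈ {7, 6}` and the defect is `m - 1 - 2r ≤ 3`; the SWAPPED reading says
  `rank (Hess per_4)(y) ≤ 3` for every `y ∈ V`, which forces all `2 × 2` subpermanents to vanish
  on `V` (`SymPencilPerFourHessianBlocks.finrank_le_four_of_sum_sq_swap`), so `dim V ≤ 4`: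
  contradiction.

Also: the window `23 ≤ sdc(per₄) ≤ 306` (`sdc_perPoly_four_window_twentyThree`).

HONEST FRAMING: a finite data point (`n = 4`: `+7` over the variable count).  The new lever is the
symmetry `½ yᵀ Hess(u) y = ½ uᵀ Hess(y) u` of the `s²`-coefficient read through the bilinear
`t(u, y)`; it does not generalise past the quadratic wall (the kernel package itself saturates at
`2n² - 3`), the crux `SdcSuperquadratic` is not touched, and nothing here bears on `VP ≠ VNP`.
The next size `m = 23` has the case `(r, dim V) = (9, 7)` with defect `4`, outside both levers.
[folklore]
-/

noncomputable section

-- single-conjunct layout: Sub = Summit, duplicated namespace component intended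
set_option linter.dupNamespace false

namespace Summit.ValiantsHypothesis.ValiantsHypothesis.Theorems.SymPencilSdcPerFourTwentyThree

open Matrix MvPolynomial Module
open Literature.Computability.AlgebraicComplexity
open Summit.ValiantsHypothesis.ValiantsHypothesis.Theorems.SymPencilSdcPerFourKernelPackage
open Summit.ValiantsHypothesis.ValiantsHypothesis.Theorems.SymPencilPerFourHessianBlocks
open Summit.ValiantsHypothesis.ValiantsHypothesis.Theorems.SymPencilSdcSuperquadraticStubBlockRankFour
open Summit.ValiantsHypothesis.ValiantsHypothesis.Theorems.SymPencilBoxFourEquality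
open Summit.ValiantsHypothesis.ValiantsHypothesis.Theorems.SymPencilSdcPerThreeWindow
open Summit.ValiantsHypothesis.ValiantsHypothesis.Theorems.SymPencilSdcPerFourWindow

/-- **No symmetric affine determinantal representation of `per_4` has size `≤ 22`**
(characteristic `0`). [folklore] -/
theorem false_of_isSymm_isAffineDetRepr_perPoly_four_le_twentyTwo (K : Type*) [Field K]
    [CharZero K] {m : ℕ} (hm : m ≤ 22) {A : Matrix (Fin m) (Fin m) (MvPolynomial (Fin 4 × Fin 4) K)}
    (hS : A.IsSymm) (hA : IsAffineDetRepr (perPoly (Fin 4) K) A) : False := by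
  obtain ⟨r, V, hVr, hrm, hV8, hV3, hsq, hswap⟩ :=
    kernel_package₂_of_isSymm_isAffineDetRepr_perPoly_four K hS hA
  by_cases hr : r = 8
  · -- `dim V = 8`: BoxFour equality case + the two-free-rows block
    have hV : finrank K V = 8 := by omega
    obtain ⟨c, hc⟩ := hsq 5 (by omega)
    exact not_sum_sq_family_of_card_lt (ι := Fin 5) (by rw [Fintype.card_fin]; norm_num) V hV
      (two_rows_or_two_cols V hV3 hV) fun u => by
        obtain ⟨Λ, hΛ⟩ := hc u
        exact ⟨c, Λ, hΛ⟩
  · -- `dim V ∈ {6, 7}`, defect `≤ 3`: the Hessian of `per_4` has rank `≤ 3` on `V`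
    obtain ⟨c, hc⟩ := hswap 3 (by omega)
    have h4 := finrank_le_four_of_sum_sq_swap (ι := Fin 3) (by rw [Fintype.card_fin]; norm_num) V
      fun y hy => by
        obtain ⟨Λ, hΛ⟩ := hc y hy
        exact ⟨c, Λ, hΛ⟩
    omega

/-- **`sdc(per_4) ≥ 23`** over any field of characteristic `0`: a symmetric affine determinantal
representation of `per_4` of size `m` has `23 ≤ m`. [folklore] -/
theorem twentyThree_le_of_isSymm_isAffineDetRepr_perPoly_four (K : Type*) [Field K] [CharZero K]
    {m : ℕ} {A : Matrix (Fin m) (Fin m) (MvPolynomial (Fin 4 × Fin 4) K)} (hS : A.IsSymm)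
    (hA : IsAffineDetRepr (perPoly (Fin 4) K) A) : 23 ≤ m := by
  by_contra hlt
  exact false_of_isSymm_isAffineDetRepr_perPoly_four_le_twentyTwo K (by omega) hS hA

/-- **`sdc(per_4) ≥ 4² + 7`** over `ℂ`, in the language of the route `SymPencil`. [folklore] -/
theorem sq_add_seven_le_of_isSymm_isAffineDetRepr_perPoly_four (m : ℕ)
    (A : Matrix (Fin m) (Fin m) (MvPolynomial (Fin 4 × Fin 4) ℂ)) (hS : A.IsSymm)
    (hA : IsAffineDetRepr (perPoly (Fin 4) ℂ) A) : 4 ^ 2 + 7 ≤ m :=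
  twentyThree_le_of_isSymm_isAffineDetRepr_perPoly_four ℂ hS hA

/-- **The window `23 ≤ sdc(per₄) ≤ 306`** over any field of characteristic `0`
(upper bound: Quarez, `SymPencilSdcPerFourWindow.sdc_perPoly_four_le`). [folklore] -/
theorem sdc_perPoly_four_window_twentyThree (K : Type*) [Field K] [CharZero K] :
    23 ≤ symmDeterminantalComplexity (perPoly (Fin 4) K) ∧
      symmDeterminantalComplexity (perPoly (Fin 4) K) ≤ 306 := by
  letI : Invertible (2 : K) := invertibleOfNonzero two_ne_zero
  refine ⟨?_, sdc_perPoly_four_le K two_ne_zero⟩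
  obtain ⟨A, hS, hA⟩ :=
    hasSymmDetRepr_symmDeterminantalComplexity ⟨_, hasSymmDetRepr_perPoly_quarez K 4⟩
  exact twentyThree_le_of_isSymm_isAffineDetRepr_perPoly_four K hS hA

/-- The complex instance: `23 ≤ sdc(per₄) ≤ 306` over `ℂ`. [folklore] -/
theorem sdc_perPoly_four_window_twentyThree_complex :
    23 ≤ symmDeterminantalComplexity (perPoly (Fin 4) ℂ) ∧
      symmDeterminantalComplexity (perPoly (Fin 4) ℂ) ≤ 306 :=
  sdc_perPoly_four_window_twentyThree ℂ

end Summit.ValiantsHypothesis.ValiantsHypothesis.Theorems.SymPencilSdcPerFourTwentyThree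

end
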